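import Summits.Ventures.YMGap.RobustBall.StateStability
import Literature.Probability.LatticeModels.DobrushinFiniteRangePotentialComparison
import HarnessLib

/-!
# Venture YMGap, track ROBUST-BALL (Y2) — LOCAL SOURCES ARE SCREENED AT THE CLUSTERING RATE:
# the exponential quasi-locality of the state map `W ↦ μ_W` on the tier-1 `ℤ^d` ball

HONEST FRAMING. WHAT THIS IS: a venture file (cell `pub-ymgap`, track Y2 ROBUST-BALL, seat rb-p1, theorems only).
Strong-coupling LATTICE statements for `SU(N)` lattice Yang–Mills on `ℤ^d`.  Setting: a member `(W, supp)` of the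
robust ball whose `SU(N)` specification `perturbedYM (fundamentalRep (Fin N)) (N β) W supp` is a Dobrushin contraction
in the Vasserstein form over its natural range (`IsKRContraction … suFrobDist (perturbedNbr supp) C`, row sums
`≤ ρ < 1`; every landed door — pair A, Bakry–Émery, quarter modulus — produces one), of `ℓ^∞`-range `R`; and a
SOURCE: ANY bounded adapted link potential `V`, locally listed by `suppV`, of ANY strength and ANY range (a Wilson-loop
source `t · Re tr U_C / N`, couplings changed on a region, any finite collection of gauge-invariant insertions …),
whose terms have one-link oscillation loads `≤ bV e`, and `bV e ≤ 0` at every link `e` the source does not load.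

THE THEOREM (`abs_integral_sub_integral_le_of_source_profile`, profile form; Föllmer's Comparison Theorem (2.8) with
a LOCALISED defect (2.10)).  For every DLR state `μ` of the member, EVERY DLR state `ν` of the modified action
`W + V` (listed by `supp ∪ suppV`), every profile `ℓ : links → ℕ` growing by at most `1` along `perturbedNbr supp`
and vanishing on the loaded links of the source, and every bounded local `f` on `Δ` with Frobenius-Lipschitz vector `δ`:

  `|∫ f dμ − ∫ f dν| ≤ (√N/2 · min(B, 4)) / (1 − ρ) · Σ_{y ∈ Δ} ρ^{ℓ y} δ_y`,   `B = sup_e bV e`.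

The one-link defect between the two specifications at a link `x` is Grüss's bound `√N bV(x)/2` (linear response)
capped by the trivial Kantorovich–Rubinstein diameter bound `2√N` (ANY strength), and it VANISHES at the links the
source does not load; the geometric super-solution of the tree (`DobrushinMetric.superSolution_geometric`) then
localises Föllmer's estimate.  Metric forms (companion file `LocalSourceScreeningMetric.lean`): with
`ℓ = ⌊dist(·, S)/max(1,R)⌋` for a finite set `S` of links carrying the source,
`|∫ f dμ − ∫ f dν| ≤ (√N/2 · min(B,4))/(1 − ρ) · ρ^{⌊d(Δ,S)/max(1,R)⌋} · Σ δ`, the exponential reading with the clustering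
rate of `UniformMassGapKR`, `κ = −log max(ρ, 1/2)`: `≤ (√N/2 · min(B,4))/(1 − max(ρ,½)) · e^{κ} · e^{−(κ/max(1,R)) d(Δ,S)} · Σ δ`,
and the Lipschitz-cylinder form (Shen–Zhu–Zhu's observable class, `Σ δ = #Λ · K_F`).  READING: on the certified ball a static source / local change of the action is invisible beyond
the certified correlation length — screening at the clustering rate, with a constant (`2√N/(1 − ρ)`) that does not
see the source's strength; for small sources the LINEAR RESPONSE `∂μ_W(F)/∂W_X` decays like `e^{−κ d(X, F)/max(1,R)}`
(Gross 1981 / Künsch 1982: the Gibbs state is a quasi-local function of the interaction in Dobrushin's regime).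
The global case `ℓ ≡ 0` is ds-1's STATE-STABILITY (`StateStability.abs_integral_sub_integral_le_of_members`).
WHAT THIS IS NOT: a one-sided Dobrushin-comparison bound (the true screening length may be shorter); only the
member's side contracts — nothing is claimed about uniqueness for the modified action; lattice strong coupling only,
nothing about the continuum limit or a Clay-sense mass gap.

References (mechanism; nothing is cited as a named fact): H. Föllmer, LNM 1362 (1988), Ch. I, Comparison Theorem
(2.8), (2.10), (2.23); H.-O. Georgii, *Gibbs Measures and Phase Transitions* (2011), Thm. 8.20, Cor. 8.23;
L. Gross, J. Stat. Phys. 25 (1981) 57–72; H. Künsch, Commun. Math. Phys. 84 (1982) 207–222; G. Grüss, Math. Z. 39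
(1935) 215–226.
-/

noncomputable section

open MeasureTheory Function Finset ProbabilityTheory Real
open scoped NNReal
open Literature.Probability.LatticeModels
open Literature.Probability.LatticeModels.DobrushinMetric
open Literature.MathematicalPhysics.QuantumLattice
open Literature.MathematicalPhysics.QuantumFieldTheory hiding ZdEdge
open Summit.Ventures.YMGap.RobustBall.StateStability (abs_tilt_sub_tilt_le_of_osc_sub)

namespace Summit.Ventures.YMGap.RobustBall

variable {d N : ℕ}

/-! ## §0 Bookkeeping: sums of potentials, sub-families, the diameter cap -/

section Bookkeeping

variable {V S : Type*} [DecidableEq V] [MeasurableSpace S]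

omit [MeasurableSpace S] in
/-- The finite-volume Hamiltonian is additive in the potential: `H^{Φ + Ψ}_Λ = H^{Φ}_Λ + H^{Ψ}_Λ` (same family). -/
theorem hamiltonianIn_add_apply (Φ Ψ : Potential V S) (supp : Finset V → Finset (Finset V)) (Λ : Finset V)
    (σ : V → S) : hamiltonianIn (Φ + Ψ) supp Λ σ = hamiltonianIn Φ supp Λ σ + hamiltonianIn Ψ supp Λ σ := by
  simp only [hamiltonianIn, Pi.add_apply, Finset.sum_add_distrib]

omit [MeasurableSpace S] in
/-- **Enlarging the support family does not change the Hamiltonian**: if `Φ` is supported by `supp` and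
`supp Λ ⊆ supp' Λ`, the extra sets listed by `supp'` carry `Φ_A = 0`. -/
theorem hamiltonianIn_eq_of_subfamily {Φ : Potential V S} {supp supp' : Finset V → Finset (Finset V)}
    (hsupp : Φ.IsSupportedBy supp) (hsub : ∀ Λ, supp Λ ⊆ supp' Λ) (Λ : Finset V) (σ : V → S) :
    hamiltonianIn Φ supp' Λ σ = hamiltonianIn Φ supp Λ σ := by
  unfold hamiltonianIn
  symm
  refine Finset.sum_subset (fun A hA => ?_) (fun A hA hA' => ?_)
  · rw [Finset.mem_filter] at hA ⊢
    exact ⟨hsub Λ hA.1, hA.2⟩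
  · rw [Finset.mem_filter] at hA
    by_contra hne
    have hΦ : Φ A ≠ 0 := fun h0 => hne (by rw [h0]; rfl)
    exact hA' (Finset.mem_filter.2 ⟨hsupp Λ A hA.2 hΦ, hA.2⟩)

omit [MeasurableSpace S] in
/-- The sum of two locally listed potentials is listed by the union of the families. -/
theorem isSupportedBy_add_union {Φ Ψ : Potential V S} {supp suppV : Finset V → Finset (Finset V)}
    (hΦ : Φ.IsSupportedBy supp) (hΨ : Ψ.IsSupportedBy suppV) :
    (Φ + Ψ).IsSupportedBy (fun Λ => supp Λ ∪ suppV Λ) := by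
  intro Λ A hA hne
  rw [Finset.mem_union]
  by_cases hΦA : Φ A = 0
  · right
    refine hΨ Λ A hA fun hΨA => hne ?_
    rw [Pi.add_apply, hΦA, hΨA, add_zero]
  · exact Or.inl (hΦ Λ A hA hΦA)

omit [DecidableEq V] in
/-- The sum of two adapted potentials is adapted. -/
theorem isAdapted_add {Φ Ψ : Potential V S} (hΦ : Φ.IsAdapted) (hΨ : Ψ.IsAdapted) : (Φ + Ψ).IsAdapted :=
  fun A => ⟨fun σ τ h => by simp only [Pi.add_apply, (hΦ A).1 h, (hΨ A).1 h], (hΦ A).2.add (hΨ A).2⟩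

/-- **The diameter cap**: two probability measures on `SU(N)` are within Kantorovich–Rubinstein distance `2√N · L`
on `L`-Lipschitz test functions for the Frobenius distance (`suFrobDist ≤ 2√N`) — whatever the measures are. -/
theorem abs_integral_sub_integral_le_diam (σ₁ σ₂ : Measure (Matrix.specialUnitaryGroup (Fin N) ℂ))
    [IsProbabilityMeasure σ₁] [IsProbabilityMeasure σ₂]
    (φ : Matrix.specialUnitaryGroup (Fin N) ℂ → ℝ) (L : ℝ) (hφm : Measurable φ) (hφb : ∃ M, ∀ s, |φ s| ≤ M)
    (hφL : ∀ a b, |φ a - φ b| ≤ L * suFrobDist a b) (hL : 0 ≤ L) :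
    |(∫ s, φ s ∂σ₁) - ∫ s, φ s ∂σ₂| ≤ 2 * Real.sqrt N * L := by
  obtain ⟨M, hM⟩ := hφb
  have hMn : ∀ s, ‖φ s‖ ≤ M := fun s => by rw [Real.norm_eq_abs]; exact hM s
  have hi₁ : Integrable φ σ₁ := Integrable.of_bound hφm.aestronglyMeasurable M (ae_of_all _ hMn)
  have hi₂ : Integrable φ σ₂ := Integrable.of_bound hφm.aestronglyMeasurable M (ae_of_all _ hMn)
  have hdiam : ∀ a b, |φ a - φ b| ≤ 2 * Real.sqrt N * L := fun a b =>
    (hφL a b).trans (by nlinarith [suFrobDist_le a b, suFrobDist_nonneg a b])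
  -- `|∫ φ dσ₁ − ∫ φ dσ₂| = |∫ (φ a − ∫ φ dσ₂) dσ₁(a)|`
  have h1 : (∫ s, φ s ∂σ₁) - ∫ s, φ s ∂σ₂ = ∫ a, (φ a - ∫ s, φ s ∂σ₂) ∂σ₁ := by
    rw [integral_sub hi₁ (integrable_const _), integral_const, smul_eq_mul, probReal_univ, one_mul]
  have h2 : ∀ a, |φ a - ∫ s, φ s ∂σ₂| ≤ 2 * Real.sqrt N * L := fun a => by
    have e : φ a - ∫ s, φ s ∂σ₂ = ∫ b, (φ a - φ b) ∂σ₂ := by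
      rw [integral_sub (integrable_const _) hi₂, integral_const, smul_eq_mul, probReal_univ, one_mul]
    rw [e]
    calc |∫ b, (φ a - φ b) ∂σ₂| ≤ ∫ b, |φ a - φ b| ∂σ₂ := abs_integral_le_integral_abs
      _ ≤ ∫ _b, 2 * Real.sqrt N * L ∂σ₂ :=
          integral_mono ((integrable_const _).sub hi₂).abs (integrable_const _) (hdiam a)
      _ = 2 * Real.sqrt N * L := by simp
  rw [h1]
  calc |∫ a, (φ a - ∫ s, φ s ∂σ₂) ∂σ₁| ≤ ∫ a, |φ a - ∫ s, φ s ∂σ₂| ∂σ₁ := abs_integral_le_integral_abs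
    _ ≤ ∫ _a, 2 * Real.sqrt N * L ∂σ₁ :=
        integral_mono (hi₁.sub (integrable_const _)).abs (integrable_const _) h2
    _ = 2 * Real.sqrt N * L := by simp

end Bookkeeping

/-! ## §1 The one-link SOURCE defect -/

/-- A locally finitely listed bounded potential has a bounded one-link Hamiltonian through `x`. -/
theorem exists_abs_hamiltonianIn_singleton_update_le {W : Potential (ZdEdge d) (Matrix.specialUnitaryGroup (Fin N) ℂ)}
    (hWb : ∀ X, ∃ C, ∀ U, |W X U| ≤ C) (supp : Finset (ZdEdge d) → Finset (Finset (ZdEdge d)))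
    (x : ZdEdge d) (η : LGConfig d (Matrix.specialUnitaryGroup (Fin N) ℂ)) :
    ∃ C, ∀ g : Matrix.specialUnitaryGroup (Fin N) ℂ, |hamiltonianIn W supp {x} (Function.update η x g)| ≤ C := by
  classical
  choose Cb hCb using hWb
  refine ⟨∑ X ∈ (supp {x}).filter (fun X => (X ∩ {x}).Nonempty), Cb X, fun g => ?_⟩
  unfold hamiltonianIn
  exact (Finset.abs_sum_le_sum_abs _ _).trans (Finset.sum_le_sum fun X _ => hCb X _)

/-- **The one-link SOURCE defect.**  Member `(W, supp)` and source `(V, suppV)` (bounded, measurable terms,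
locally listed); the one-link laws at `x`, with the SAME exterior `η`, of `N β S_W + W` (listed by `supp`) and of
`N β S_W + W + V` (listed by `supp ∪ suppV`) are within Kantorovich–Rubinstein distance
`(√N/2) · min(bV x, 4)` on Frobenius-Lipschitz test functions, where `bV x ≥ Σ_{X ∈ suppV{x}, x ∈ X} osc_X(x)` is the
one-link oscillation load of the source at `x`: Grüss's inequality for the tilt by `H^V_{x}` (linear in the source)
and the diameter cap `2√N` (any strength).  In particular the defect is `0` at links the source does not load. -/
theorem oneLink_source_defect (β : ℝ) {W V : Potential (ZdEdge d) (Matrix.specialUnitaryGroup (Fin N) ℂ)}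
    (hW : W.IsAdapted) (hWb : ∀ X, ∃ C, ∀ U, |W X U| ≤ C)
    (hV : V.IsAdapted) (hVb : ∀ X, ∃ C, ∀ U, |V X U| ≤ C)
    {supp suppV : Finset (ZdEdge d) → Finset (Finset (ZdEdge d))} (hsupp : W.IsSupportedBy supp)
    (hsuppV : V.IsSupportedBy suppV)
    {oscV : Finset (ZdEdge d) → ZdEdge d → ℝ} (hoscV : ∀ X, Dobrushin.IsOscBound (V X) (oscV X))
    {bV : ZdEdge d → ℝ} (x : ZdEdge d) (hbV : ∑ X ∈ (suppV {x}).filter (fun X => x ∈ X), oscV X x ≤ bV x)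
    (η : LGConfig d (Matrix.specialUnitaryGroup (Fin N) ℂ))
    (φ : Matrix.specialUnitaryGroup (Fin N) ℂ → ℝ) (L : ℝ) (hφm : Measurable φ) (hφb : ∃ M, ∀ s, |φ s| ≤ M)
    (hL : 0 ≤ L) (hφL : ∀ a b, |φ a - φ b| ≤ L * suFrobDist a b) :
    |∫ s, φ s ∂(siteLaw (perturbedYM (fundamentalRep (Fin N)) (N * β) W supp) x η) -
        ∫ s, φ s ∂(siteLaw (perturbedYM (fundamentalRep (Fin N)) (N * β) (W + V)
          (fun Λ => supp Λ ∪ suppV Λ)) x η)| ≤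
      Real.sqrt N / 2 * min (bV x) 4 * L := by
  classical
  haveI : SecondCountableTopology (Matrix (Fin N) (Fin N) ℂ) :=
    inferInstanceAs (SecondCountableTopology (Fin N → Fin N → ℂ))
  haveI : SecondCountableTopology (Matrix.specialUnitaryGroup (Fin N) ℂ) :=
    Topology.IsEmbedding.subtypeVal.secondCountableTopology
  have hWm : ∀ X, Measurable (W X) := fun X => (hW X).2
  have hVm : ∀ X, Measurable (V X) := fun X => (hV X).2
  have hWV : (W + V).IsAdapted := isAdapted_add hW hV
  have hWVm : ∀ X, Measurable ((W + V) X) := fun X => (hWV X).2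
  have hWVb : ∀ X, ∃ C, ∀ U, |(W + V) X U| ≤ C := fun X => by
    obtain ⟨C₁, h₁⟩ := hWb X; obtain ⟨C₂, h₂⟩ := hVb X
    exact ⟨C₁ + C₂, fun U => (abs_add_le _ _).trans (add_le_add (h₁ U) (h₂ U))⟩
  -- both one-link laws are probability measures (needed for the diameter cap)
  have hγ : IsSpecification (perturbedYM (d := d) (fundamentalRep (Fin N)) (N * β) W supp) :=
    isSpecification_perturbedYM _ (continuous_fundamentalRep (Fin N)) _ hW hWb hsupp
  have hγ' : IsSpecification (perturbedYM (d := d) (fundamentalRep (Fin N)) (N * β) (W + V)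
      (fun Λ => supp Λ ∪ suppV Λ)) :=
    isSpecification_perturbedYM _ (continuous_fundamentalRep (Fin N)) _ hWV hWVb (isSupportedBy_add_union hsupp hsuppV)
  have hP₁ := isProbabilityMeasure_siteLaw hγ x η
  have hP₂ := isProbabilityMeasure_siteLaw hγ' x η
  rw [siteLaw_perturbedYM_thooft β hWm supp x η] at hP₁
  rw [siteLaw_perturbedYM_thooft β hWVm _ x η] at hP₂
  rw [siteLaw_perturbedYM_thooft β hWm supp x η, siteLaw_perturbedYM_thooft β hWVm _ x η]
  set U₁ : Matrix.specialUnitaryGroup (Fin N) ℂ → ℝ := fun g => hamiltonianIn W supp {x} (Function.update η x g)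
    with hU₁
  set U₂ : Matrix.specialUnitaryGroup (Fin N) ℂ → ℝ := fun g =>
    hamiltonianIn (W + V) (fun Λ => supp Λ ∪ suppV Λ) {x} (Function.update η x g) with hU₂
  set UV : Matrix.specialUnitaryGroup (Fin N) ℂ → ℝ := fun g => hamiltonianIn V suppV {x} (Function.update η x g)
    with hUV
  have hU₁m : Measurable U₁ := (measurable_hamiltonianIn hWm supp {x}).comp (measurable_update η)
  have hU₂m : Measurable U₂ := (measurable_hamiltonianIn hWVm _ {x}).comp (measurable_update η)
  have hU₁b : ∃ C, ∀ g, |U₁ g| ≤ C := exists_abs_hamiltonianIn_singleton_update_le hWb supp x η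
  have hU₂b : ∃ C, ∀ g, |U₂ g| ≤ C := exists_abs_hamiltonianIn_singleton_update_le hWVb _ x η
  haveI := hP₁
  haveI := hP₂
  -- the difference of the two one-link perturbations is the one-link Hamiltonian of the source
  have hdiff : ∀ g, U₁ g - U₂ g = -UV g := fun g => by
    simp only [hU₁, hU₂, hUV]
    rw [hamiltonianIn_add_apply,
      hamiltonianIn_eq_of_subfamily hsupp (fun Λ => Finset.subset_union_left) {x},
      hamiltonianIn_eq_of_subfamily hsuppV (supp' := fun Λ => supp Λ ∪ suppV Λ)
        (fun Λ => Finset.subset_union_right) {x}]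
    ring
  have hoscUV : ∀ g g', UV g - UV g' ≤ bV x := fun g g' => by
    have h := hamiltonianIn_singleton_update_osc (supp := suppV) hoscV x η g g'
    simp only [hUV]; linarith
  have hoscD : ∀ a a', |(U₁ a - U₂ a) - (U₁ a' - U₂ a')| ≤ bV x := fun a a' => by
    rw [hdiff, hdiff, abs_le]
    constructor <;> linarith [hoscUV a a', hoscUV a' a]
  -- Grüss (linear in the source)
  have hG := abs_tilt_sub_tilt_le_of_osc_sub (stapleField β x η) hU₁m hU₁b hU₂m hU₂b hoscD φ L hφm hφb hL hφL
  -- the diameter cap (any strength)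
  have hD := abs_integral_sub_integral_le_diam
    ((haarProbability (Matrix.specialUnitaryGroup (Fin N) ℂ)).tilted
      fun g => (N : ℝ) * ((g : Matrix (Fin N) (Fin N) ℂ) * stapleField β x η).trace.re - U₁ g)
    ((haarProbability (Matrix.specialUnitaryGroup (Fin N) ℂ)).tilted
      fun g => (N : ℝ) * ((g : Matrix (Fin N) (Fin N) ℂ) * stapleField β x η).trace.re - U₂ g)
    φ L hφm hφb hφL hL
  have hsq : 0 ≤ Real.sqrt N := Real.sqrt_nonneg _
  rcases le_total (bV x) 4 with h4 | h4
  · rw [min_eq_left h4]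
    simpa only [hU₁, hU₂] using hG.trans (le_of_eq (by ring))
  · rw [min_eq_right h4]
    calc _ ≤ 2 * Real.sqrt N * L := by simpa only [hU₁, hU₂] using hD
      _ = Real.sqrt N / 2 * 4 * L := by ring

/-! ## §2 Screening of a local source: the profile form -/

/-- **LOCAL SOURCES ARE SCREENED AT THE CLUSTERING RATE — profile form** (Föllmer's Comparison Theorem (2.8) with
the localised defect (2.10)).  Member `(W, supp)` whose `SU(N)` specification is a Dobrushin contraction over
`perturbedNbr supp` with row sums `≤ ρ < 1`; source `(V, suppV)` — bounded, adapted, locally listed, ANY strength and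
range — with one-link oscillation loads `≤ bV ≤ B`; a profile `ℓ : links → ℕ` that grows by at most `1` along
`perturbedNbr supp` and such that the source loads only links where `ℓ = 0` (`bV e ≤ 0` if `ℓ e ≠ 0`).  Then every
DLR state `μ` of the member and EVERY DLR state `ν` of the modified action `W + V` satisfy, for every bounded local `f`
on `Δ` with Frobenius-Lipschitz vector `δ`:
`|∫ f dμ − ∫ f dν| ≤ (√N/2 · min(B,4))/(1 − ρ) · Σ_{y ∈ Δ} ρ^{ℓ y} δ_y`. -/
theorem abs_integral_sub_integral_le_of_source_profile (hd : 1 ≤ d) {β ρ : ℝ}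
    {W : Potential (ZdEdge d) (Matrix.specialUnitaryGroup (Fin N) ℂ)} (hW : W.IsAdapted)
    (hWb : ∀ X, ∃ C, ∀ U, |W X U| ≤ C)
    {supp : Finset (ZdEdge d) → Finset (Finset (ZdEdge d))} (hsupp : W.IsSupportedBy supp)
    {C : ZdEdge d → ZdEdge d → ℝ}
    (hKR : IsKRContraction (perturbedYM (d := d) (fundamentalRep (Fin N)) (N * β) W supp) suFrobDist
      (perturbedNbr supp) C)
    (hrow : ∀ x, ∑ y ∈ perturbedNbr supp x, C x y ≤ ρ) (hρ : ρ < 1)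
    {V : Potential (ZdEdge d) (Matrix.specialUnitaryGroup (Fin N) ℂ)} (hV : V.IsAdapted)
    (hVb : ∀ X, ∃ C, ∀ U, |V X U| ≤ C)
    {suppV : Finset (ZdEdge d) → Finset (Finset (ZdEdge d))} (hsuppV : V.IsSupportedBy suppV)
    {oscV : Finset (ZdEdge d) → ZdEdge d → ℝ} (hoscV : ∀ X, Dobrushin.IsOscBound (V X) (oscV X))
    {bV : ZdEdge d → ℝ} (hbV : ∀ e, ∑ X ∈ (suppV {e}).filter (fun X => e ∈ X), oscV X e ≤ bV e)
    {B : ℝ} (hB : ∀ e, bV e ≤ B)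
    (ℓ : ZdEdge d → ℕ) (hℓV : ∀ e, ℓ e ≠ 0 → bV e ≤ 0) (hℓ : ∀ x, ∀ y ∈ perturbedNbr supp x, ℓ x ≤ ℓ y + 1)
    {μ ν : Measure (LGConfig d (Matrix.specialUnitaryGroup (Fin N) ℂ))}
    (hμ : μ ∈ perturbedGibbsMeasures (d := d) (fundamentalRep (Fin N)) (N * β) W supp)
    (hν : ν ∈ perturbedGibbsMeasures (d := d) (fundamentalRep (Fin N)) (N * β) (W + V)
      (fun Λ => supp Λ ∪ suppV Λ))
    {f : LGConfig d (Matrix.specialUnitaryGroup (Fin N) ℂ) → ℝ} (hfm : Measurable f)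
    {Δ : Finset (ZdEdge d)} (hfdep : DependsOn f (↑Δ : Set (ZdEdge d))) {M : ℝ} (hM : ∀ σ, |f σ| ≤ M)
    {δ : ZdEdge d → ℝ} (hδ : IsLipBound suFrobDist f δ) :
    |(∫ σ, f σ ∂μ) - ∫ σ, f σ ∂ν| ≤
      Real.sqrt N / 2 * min B 4 / (1 - ρ) * ∑ y ∈ Δ, ρ ^ ℓ y * δ y := by
  classical
  haveI : SecondCountableTopology (Matrix (Fin N) (Fin N) ℂ) :=
    inferInstanceAs (SecondCountableTopology (Fin N → Fin N → ℂ))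
  haveI : SecondCountableTopology (Matrix.specialUnitaryGroup (Fin N) ℂ) :=
    Topology.IsEmbedding.subtypeVal.secondCountableTopology
  have hWV : (W + V).IsAdapted := isAdapted_add hW hV
  have hWVb : ∀ X, ∃ C, ∀ U, |(W + V) X U| ≤ C := fun X => by
    obtain ⟨C₁, h₁⟩ := hWb X; obtain ⟨C₂, h₂⟩ := hVb X
    exact ⟨C₁ + C₂, fun U => (abs_add_le _ _).trans (add_le_add (h₁ U) (h₂ U))⟩
  have hsuppWV : (W + V).IsSupportedBy (fun Λ => supp Λ ∪ suppV Λ) := isSupportedBy_add_union hsupp hsuppV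
  -- nonnegativity bookkeeping
  have hC0 : ∀ x y, 0 ≤ C x y := hKR.nonneg
  have hρ0 : 0 ≤ ρ := by
    have hd0 : 0 < d := hd
    let e₀ : ZdEdge d := (0, ⟨0, hd0⟩)
    exact (Finset.sum_nonneg fun y _ => hC0 e₀ y).trans (hrow e₀)
  have hbV0 : ∀ e, 0 ≤ bV e := fun e =>
    (Finset.sum_nonneg fun X _ => (hoscV X).nonneg e).trans (hbV e)
  have hsq : 0 ≤ Real.sqrt N := Real.sqrt_nonneg _
  -- the two specifications
  have hγ : IsSpecification (perturbedYM (d := d) (fundamentalRep (Fin N)) (N * β) W supp) :=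
    isSpecification_perturbedYM _ (continuous_fundamentalRep (Fin N)) _ hW hWb hsupp
  have hγ' : IsSpecification (perturbedYM (d := d) (fundamentalRep (Fin N)) (N * β) (W + V)
      (fun Λ => supp Λ ∪ suppV Λ)) :=
    isSpecification_perturbedYM _ (continuous_fundamentalRep (Fin N)) _ hWV hWVb hsuppWV
  have hμ' : IsGibbsMeasure (perturbedYM (d := d) (fundamentalRep (Fin N)) (N * β) W supp) μ := hμ
  have hν' : IsGibbsMeasure (perturbedYM (d := d) (fundamentalRep (Fin N)) (N * β) (W + V)
      (fun Λ => supp Λ ∪ suppV Λ)) ν := hν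
  have hR₀ : (0 : ℝ) ≤ 2 * Real.sqrt N := by positivity
  -- the localised defect
  set b : ZdEdge d → ℝ := fun x => Real.sqrt N / 2 * min (bV x) 4 with hb
  have hb0 : ∀ x, 0 ≤ b x := fun x => by
    simp only [hb]; exact mul_nonneg (by positivity) (le_min (hbV0 x) (by norm_num))
  have hbB : ∀ x, b x ≤ Real.sqrt N / 2 * min B 4 := fun x =>
    mul_le_mul_of_nonneg_left (min_le_min_right 4 (hB x)) (by positivity)
  have hbℓ : ∀ x, ℓ x ≠ 0 → b x = 0 := fun x hx => by
    have : bV x = 0 := le_antisymm (hℓV x hx) (hbV0 x)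
    simp [hb, this]
  have hker : ∀ (x : ZdEdge d) (η : LGConfig d (Matrix.specialUnitaryGroup (Fin N) ℂ))
      (φ : Matrix.specialUnitaryGroup (Fin N) ℂ → ℝ) (L : ℝ), Measurable φ → (∃ M, ∀ s, |φ s| ≤ M) →
      0 ≤ L → (∀ a a', |φ a - φ a'| ≤ L * suFrobDist a a') →
      |(∫ s, φ s ∂(siteLaw (perturbedYM (fundamentalRep (Fin N)) (N * β) W supp) x η)) -
          ∫ s, φ s ∂(siteLaw (perturbedYM (fundamentalRep (Fin N)) (N * β) (W + V)
            (fun Λ => supp Λ ∪ suppV Λ)) x η)| ≤ b x * L :=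
    fun x η φ L hφm hφb hL hφL => by
      simpa only [hb] using oneLink_source_defect β hW hWb hV hVb hsupp hsuppV hoscV x (hbV x) η φ L hφm hφb hL hφL
  -- the geometric super-solution
  have hsuper := superSolution_geometric (nbr := perturbedNbr supp) hC0 hρ0 hρ hrow hb0 hbB ℓ hbℓ hℓ
  have hd0 : ∀ y, 0 ≤ Real.sqrt N / 2 * min B 4 / (1 - ρ) * ρ ^ ℓ y := fun y => by
    have hB0 : 0 ≤ Real.sqrt N / 2 * min B 4 := (hb0 y).trans (hbB y)
    have : 0 < 1 - ρ := sub_pos.2 hρ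
    positivity
  have key := abs_integral_sub_integral_le_of_gibbs_pair_local hγ hγ' hKR (fun _ _ => suFrobDist_nonneg _ _)
    suFrobDist_le hR₀ hρ0 hρ hrow hμ' hν' hb0 hker hd0 hsuper hfm hfdep hM hδ
  refine key.trans (le_of_eq ?_)
  rw [Finset.mul_sum]
  refine Finset.sum_congr rfl fun y _ => ?_
  ring

end Summit.Ventures.YMGap.RobustBall

end
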